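import Summits.SmoothPoincare4.SmoothPoincare4.Theorems.ConvexBisectionAcyclicBisectionExistsHurwitzMoveClasses
import HarnessLib

/-!
# N1-move, bridge (e×) `piece_e_cross`, core: ACROSS A BELT, THE RIGID SEAM TRANSPORT OF A LOOP READS ON
# THE BASE AS A RETURN-MAP READING OF THE LOOP (wave 8, worker J4, brick of stub `stub_M2geo` = node N1 ▸
# contract `node_N1_move_of_pieces` ▸ `HD` = `piece_e_cross piece_d`, line `modp-braid-orbits`, crux
# `ConvexBisection.AcyclicBisectionExists`, item stmt-SmoothPoincare4-10508; registered sub-goal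
# `helper_shadow_acrossBelt_reading`)

With the slab retraction `Π` of `…HurwitzMoveCrossSlabPi.lean` (`exists_slabRetraction`; setting in
its module docstring; here ABSTRACTED as a map `Pr` continuous on `S` with its three readings, so that this
file does not depend on the chart files): for a continuous family of loops `Y_t ⊂ S`, `t ∈ [0, 1]`, of the swept slab from
level `σb < −η/2` (read on the base as `Lb`) to level `σt > η/2` (read as `Lt`) — in the bridge (e×),
`Y_t θ = Ψ⁻¹ (R_{tT} (Ψ (y θ)))` is the RIGID seam transport of `HD` —, `Π ∘ Y` is a homotopy of base
loops from `R_{εσt/κ} ∘ Kt` to `Lt`, where **`Kt` is a `G`-TWIST READING of `K = R_{−εσb/κ} ∘ Lb`**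
(`Kt θ = φ₀ (G p)` whenever `K θ = φ₀ p`, `p` in the strip; `Kt θ = K θ` off the open annulus); hence
`shadow Lt = shadow Kt` (`shadow_eq_of_family`, `shadow_comp_ambientIsotopy`) — the input of
`helper_shadow_twistReading` (…CrossTwist), which turns it into the transvection of node N1a.  The sign
`ε = ±1` lets the same statement serve the UPWARD crossing (`ε = 1`, return map `G`) and the DOWNWARD
crossing (`ε = −1`, levels reflected, return map `G⁻¹` of `helper_exists_inverse_stripMap`).

Everything is proved; no definitions, no named facts, no `sorry`.  Reference: R. E. Gompf,
A. I. Stipsicz, *4-Manifolds and Kirby Calculus* (1999), §8.2 [GompfStipsicz1999]. [folklore]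
-/

noncomputable section

set_option linter.dupNamespace false

open scoped Manifold ContDiff Topology Real
open Set Function Filter

namespace Summit.SmoothPoincare4.SmoothPoincare4.Theorems.AcyclicBisectionExists.ModpBraidOrbits

open Literature.Topology.FourManifolds Literature.Topology.FourManifolds.LefschetzBase
open Literature.Topology.FourManifolds.HandleAttachingMap
open HurwitzMoveClasses

namespace CrossSlab

variable {g n : ℕ} {h : Fin n → HandleAttachingMap 3 2 (Base g)}
  {X₀ : Type} [TopologicalSpace X₀] [ChartedSpace (EuclideanHalfSpace 4) X₀]
  {X : Type} [TopologicalSpace X] [ChartedSpace (EuclideanHalfSpace 4) X]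

/-- **ACROSS A BELT, THE RIGID SEAM TRANSPORT READS AS A RETURN-MAP READING** (see the module
docstring): `shadow Lt = shadow Kt` for a continuous loop `Kt` which is a `G`-twist reading of
`R_{−εσb/κ} ∘ Lb` through the level-`0` chart `φ₀` and the return map `G` of H4's two-sided belt chart.
[cite: GompfStipsicz1999, §8.2] -/
theorem shadow_acrossBelt_reading
    (bX : BoundaryData (𝓡∂ 4) X₀ (𝓡 3)) (G₀ : X₀ ≃ₘ⟮𝓡∂ 4, 𝓡∂ 4⟯ X) (D : MultiAttachmentData h (𝓡∂ 4) X)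
    (R : AmbientIsotopy (𝓡∂ 4) (Base g)) (κ ε : ℝ)
    (hRflow : ∀ (t s : ℝ) (p : Base g), R.toFun t (R.toFun s p) = R.toFun (t + s) p)
    (φ₀ : ℝ × ℝ → Base g) (G : ℝ × ℝ → ℝ × ℝ) {η : ℝ}
    (S : Set bX.carrier) (lev : bX.carrier → ℝ) (σb σt : ℝ) (hσb : σb < -(η / 2)) (hσt : η / 2 < σt)
    (Pr : bX.carrier → Base g) (hPrc : ContinuousOn Pr S)
    (hPr₂ : ∀ y ∈ S, ∀ a : ↥(coresComplement h), G₀ (bX.incl y) = D.jA a → η / 2 < lev y →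
      Pr y = R.toFun (ε * σt / κ) (R.toFun (-(ε * lev y / κ)) a))
    (hPr₃ : ∀ y ∈ S, ∀ a : ↥(coresComplement h), G₀ (bX.incl y) = D.jA a → lev y < -(η / 2) →
      R.toFun (-(ε * lev y / κ)) a ∉ φ₀ '' (univ ×ˢ Icc (-(1 / 2) : ℝ) (1 / 2)) →
      Pr y = R.toFun (ε * σt / κ) (R.toFun (-(ε * lev y / κ)) a))
    (hPr₄ : ∀ y ∈ S, ∀ a : ↥(coresComplement h), G₀ (bX.incl y) = D.jA a → lev y < -(η / 2) →
      ∀ p : ℝ × ℝ, p.2 ∈ Ioo (-1 : ℝ) 1 → φ₀ p = R.toFun (-(ε * lev y / κ)) a →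
      Pr y = R.toFun (ε * σt / κ) (φ₀ (G p)))
    (Y : ℝ → Metric.sphere (0 : EuclideanSpace ℝ (Fin 2)) 1 → bX.carrier)
    (hYc : ContinuousOn (uncurry Y) (Icc (0 : ℝ) 1 ×ˢ univ)) (hYS : ∀ t ∈ Icc (0 : ℝ) 1, ∀ θ, Y t θ ∈ S)
    (hY0 : ∀ θ, lev (Y 0 θ) = σb) (hY1 : ∀ θ, lev (Y 1 θ) = σt)
    {Lb Lt : Metric.sphere (0 : EuclideanSpace ℝ (Fin 2)) 1 → Base g} (hLt : Continuous Lt)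
    {ab at' : Metric.sphere (0 : EuclideanSpace ℝ (Fin 2)) 1 → ↥(coresComplement h)}
    (hyb : ∀ θ, G₀ (bX.incl (Y 0 θ)) = D.jA (ab θ))
    (hab : ∀ θ, ((ab θ : ↥(coresComplement h)) : Base g) = Lb θ)
    (hyt : ∀ θ, G₀ (bX.incl (Y 1 θ)) = D.jA (at' θ))
    (hat : ∀ θ, ((at' θ : ↥(coresComplement h)) : Base g) = Lt θ) :
    ∃ (Kt : Metric.sphere (0 : EuclideanSpace ℝ (Fin 2)) 1 → Base g) (hKt : Continuous Kt),
      shadow g Lt hLt = shadow g Kt hKt ∧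
      (∀ θ (p : ℝ × ℝ), p.2 ∈ Ioo (-1 : ℝ) 1 → R.toFun (-(ε * σb / κ)) (Lb θ) = φ₀ p → Kt θ = φ₀ (G p)) ∧
      (∀ θ, R.toFun (-(ε * σb / κ)) (Lb θ) ∉ φ₀ '' (univ ×ˢ Ioo (-1 : ℝ) 1) →
        Kt θ = R.toFun (-(ε * σb / κ)) (Lb θ)) := by
  have flow_neg : ∀ (t : ℝ) (p : Base g), R.toFun (-t) (R.toFun t p) = p := fun t p => by
    rw [hRflow, neg_add_cancel, R.map_zero, id]
  have flow_pos : ∀ (t : ℝ) (p : Base g), R.toFun t (R.toFun (-t) p) = p := fun t p => by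
    rw [hRflow, add_neg_cancel, R.map_zero, id]
  have hRc : Continuous (uncurry R.toFun) := R.contMDiff.continuous
  have hρTc : Continuous (R.toFun (ε * σt / κ)) := hRc.comp (continuous_const.prodMk continuous_id)
  -- ### the homotopy `Pr ∘ Y`
  set F : ℝ → Metric.sphere (0 : EuclideanSpace ℝ (Fin 2)) 1 → Base g := fun t θ => Pr (Y t θ) with hF
  have hFc : ContinuousOn (uncurry F) (Icc (0 : ℝ) 1 ×ˢ univ) :=
    hPrc.comp hYc fun q hq => hYS q.1 hq.1 q.2
  have h0I : (0 : ℝ) ∈ Icc (0 : ℝ) 1 := ⟨le_rfl, zero_le_one⟩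
  have h1I : (1 : ℝ) ∈ Icc (0 : ℝ) 1 := ⟨zero_le_one, le_rfl⟩
  have hF1 : ∀ θ, F 1 θ = Lt θ := fun θ => by
    have hyS := hYS 1 h1I θ
    show Pr (Y 1 θ) = Lt θ
    rw [hPr₂ (Y 1 θ) hyS (at' θ) (hyt θ) (by rw [hY1]; exact hσt), hY1, flow_pos, hat]
  -- `Kt`
  set Kt : Metric.sphere (0 : EuclideanSpace ℝ (Fin 2)) 1 → Base g := fun θ =>
    R.toFun (-(ε * σt / κ)) (F 0 θ) with hKt
  have hF0c : Continuous (F 0) := by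
    have h1 : ContinuousOn (fun θ : Metric.sphere (0 : EuclideanSpace ℝ (Fin 2)) 1 => uncurry F ((0 : ℝ), θ))
        univ := hFc.comp (continuousOn_const.prodMk continuousOn_id) fun θ _ => ⟨h0I, trivial⟩
    exact continuousOn_univ.1 h1
  have hKtc : Continuous Kt := (hRc.comp (continuous_const.prodMk continuous_id)).comp hF0c
  have hF0 : ∀ θ, F 0 θ = (R.toFun (ε * σt / κ) ∘ Kt) θ := fun θ => by
    simp only [hKt, comp_apply]; rw [flow_pos]
  have hsh : shadow g Lt hLt = shadow g Kt hKtc := by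
    have h1 := shadow_eq_of_family F hFc (hρTc.comp hKtc) hLt hF0 hF1
    rw [← h1]
    exact shadow_comp_ambientIsotopy R (ε * σt / κ) hKtc (hρTc.comp hKtc)
  -- the twist-reading clauses at the bottom
  have hbot : ∀ θ, Y 0 θ ∈ S ∧ lev (Y 0 θ) < -(η / 2) ∧
      R.toFun (-(ε * lev (Y 0 θ) / κ)) (ab θ) = R.toFun (-(ε * σb / κ)) (Lb θ) := fun θ =>
    ⟨hYS 0 h0I θ, by rw [hY0]; exact hσb, by rw [hY0, hab]⟩
  refine ⟨Kt, hKtc, hsh, fun θ p hp hK => ?_, fun θ hK => ?_⟩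
  · obtain ⟨hyS, hdn, hbK⟩ := hbot θ
    show R.toFun (-(ε * σt / κ)) (Pr (Y 0 θ)) = φ₀ (G p)
    rw [hPr₄ (Y 0 θ) hyS (ab θ) (hyb θ) hdn p hp (by rw [hbK, hK]), flow_neg]
  · obtain ⟨hyS, hdn, hbK⟩ := hbot θ
    show R.toFun (-(ε * σt / κ)) (Pr (Y 0 θ)) = R.toFun (-(ε * σb / κ)) (Lb θ)
    have hoff : R.toFun (-(ε * lev (Y 0 θ) / κ)) (ab θ) ∉ φ₀ '' (univ ×ˢ Icc (-(1 / 2) : ℝ) (1 / 2)) := by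
      rintro ⟨p, ⟨-, hp⟩, hpb⟩
      exact hK ⟨p, ⟨trivial, by linarith [hp.1], by linarith [hp.2]⟩, by rw [← hbK]; exact hpb⟩
    rw [hPr₃ (Y 0 θ) hyS (ab θ) (hyb θ) hdn hoff, flow_neg, hbK]

end CrossSlab

/-! ## The registered form -/

/-- **Sub-goal `helper_slabEnds_apart`** (J4, bridge (e×) of the N1 contract; a short clause of
`CrossSlab.shadow_acrossBelt_reading`, fully qualified): the two end levels of the swept slab lie on opposite
sides of the belt level, outside the transition zone `|σ| ≤ η/2`. [folklore] -/
theorem helper_slabEnds_apart : ∀ (η σb σt : ℝ), 0 < η → σb < -(η / 2) → η / 2 < σt → σb < 0 ∧ 0 < σt ∧ σt - σb > η := by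
  intro η σb σt hη hσb hσt
  exact ⟨by linarith, by linarith, by linarith⟩

end Summit.SmoothPoincare4.SmoothPoincare4.Theorems.AcyclicBisectionExists.ModpBraidOrbits

end
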